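import Literature.NumberTheory.Weil1964.ArchPlacePhaseHom
import Literature.NumberTheory.Weil1964.ArchWeilDatumTensor
import HarnessLib

/-!
# The product-over-places phase homomorphism at ONE place is a block (Weil 1964, n° 12)

Topic `NumberTheory/Weil1964`; namespace `Literature.NumberTheory.Weil1964`.  KERNEL MATHEMATICS ONLY: one explicit definition
(an index bijection) and proved theorems; no `def … : Prop` record, no axiom, no proof hole.

`ArchPlacePhaseHom` §3 packages a family of homomorphisms `ι𝕎ᵥ : G v →* Sp(ℝ^{σ v} × ℝ^{σ v})` over a finite set of places `o`,
in frames `ε v : ι ≃ σ v`, as ONE homomorphism `piPhaseHom ε ι𝕎ᵥ : (Π v, G v) →* Sp(ℝ^{ι×o} × ℝ^{ι×o})` acting slice by slice.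
Consumers that factorise an archimedean Weil datum at one place `v₁` (`IsArchWeilDatum.exists_circle_twist_factorisation_clm`,
the tree's `IsBlockPair`) are typed on a block frame `σ₁ ⊕ σ₂` and ask that an element supported at `v₁` act by
`blockPhase (its own phase map) id`.  This file supplies the relabelling and that identity:

* §1 **`placeSplitEquiv ε₁ v₁ : σ₁ ⊕ (ι × {v // v ≠ v₁}) ≃ ι × o`** — the slice `v₁` read in its own frame `ε₁ : ι ≃ σ₁`
  (`inl j ↦ (ε₁⁻¹ j, v₁)`), the other slices kept (`inr (i, v) ↦ (i, v)`); its inverse on the two kinds of points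
  (`placeSplitEquiv_symm_apply_same`, `placeSplitEquiv_symm_apply_of_ne`);
* §2 **`reindexPhase_placeSplitEquiv_piPhaseHom_mulSingle`** — for `g ∈ G v₁` placed at `v₁` (`Pi.mulSingle v₁ g`):
  `reindexPhase (placeSplitEquiv (ε v₁) v₁) ⇑(piPhaseHom ε ι𝕎ᵥ (Pi.mulSingle v₁ g)) = blockPhase ⇑(ι𝕎ᵥ v₁ g) id`, and the same
  as an identity of homomorphisms into `Sp(ℝ^{σ v₁ ⊕ …})`: **`reindexSp_piPhaseHom_mulSingle :
  reindexSp (placeSplitEquiv (ε v₁) v₁) (piPhaseHom ε ι𝕎ᵥ (Pi.mulSingle v₁ g)) = spBlock (ι𝕎ᵥ v₁ g, 1)`** (`spBlock` of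
  `ArchWeilDatumTensor` §1, acting by `blockPhase`); pointwise forms along any homomorphism `ϖ : H →* Π v, G v` and section
  `sec : G v₁ →* H` with `ϖ (sec g) = Pi.mulSingle v₁ g` (`coe_piPhaseHom_comp_section`) — LITERALLY the hypothesis `hs` of a
  block pair for `ι𝕎' := (reindexSp _).comp ((piPhaseHom ε ι𝕎ᵥ).comp ϖ)` and `s := sec`.

Together with `ArchWeilDatumReindex` (`IsArchWeilDatum.reindex`) this moves a datum over `(piPhaseHom ε ι𝕎ᵥ).comp ϖ` on
`𝓢(ℝ^{ι×o})` to the block frame of the place `v₁` with no other input.  Everything is PROVED; nothing cited is a hypothesis.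

## References

* [Weil1964] A. Weil, *Sur certains groupes d'opérateurs unitaires*, Acta Math. 111 (1964), Chap. I n° 12 p. 160
  (direct sums of symplectic spaces), Chap. III n° 37 (products over places).
* [Folland1989] G. B. Folland, *Harmonic Analysis in Phase Space*, Princeton UP (1989), Prop. (1.43), §4.2 (4.23).

## Provenance

LEAN-IN-TREE rule (2026-08-18), pub-hodgecm model-construction sub-cell, discharge seat mc-discharge-3 (ticket D-3 follow-on (T2):
glue from the (J-arch) datum in the place frame to the block frame).  Nothing here is a claim of the manuscripts adjudicated by
that cell.
-/

set_option autoImplicit false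

noncomputable section

open Matrix

namespace Literature.NumberTheory.Weil1964

open Literature.Analysis.SegalBargmann Literature.RepresentationTheory.HeisenbergGroup
open Literature.RepresentationTheory.KonnoKonno2007

/-! ## §1 Splitting the place frame at one place -/

section Split

variable {ι : Type*} {o : Type*} [DecidableEq o] {σ₁ : Type*}

/-- **The split of the place frame `ι × o` at the place `v₁`**, the slice `v₁` read in its own frame `ε₁ : ι ≃ σ₁`:
`inl j ↦ (ε₁⁻¹ j, v₁)`, `inr (i, v) ↦ (i, v)` for `v ≠ v₁`. [cite: Weil1964, Chap. I n° 12, p. 160] -/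
def placeSplitEquiv (ε₁ : ι ≃ σ₁) (v₁ : o) : σ₁ ⊕ (ι × {v : o // v ≠ v₁}) ≃ ι × o where
  toFun := Sum.elim (fun j => (ε₁.symm j, v₁)) fun iv => (iv.1, iv.2.1)
  invFun iv := if h : iv.2 = v₁ then Sum.inl (ε₁ iv.1) else Sum.inr (iv.1, ⟨iv.2, h⟩)
  left_inv k := by
    rcases k with j | ⟨i, v, hv⟩
    · dsimp only [Sum.elim_inl]
      split_ifs with h
      · rw [Equiv.apply_symm_apply]
      · exact (h rfl).elim
    · dsimp only [Sum.elim_inr]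
      split_ifs with h
      · exact (hv h).elim
      · rfl
  right_inv iv := by
    obtain ⟨i, v⟩ := iv
    dsimp only
    split_ifs with h
    · rw [Sum.elim_inl, Equiv.symm_apply_apply, h]
    · rw [Sum.elim_inr]

/-- on the slice `v₁`. [folklore] -/
@[simp] theorem placeSplitEquiv_inl (ε₁ : ι ≃ σ₁) (v₁ : o) (j : σ₁) :
    placeSplitEquiv ε₁ v₁ (Sum.inl j) = (ε₁.symm j, v₁) := rfl

/-- off the slice `v₁`. [folklore] -/
@[simp] theorem placeSplitEquiv_inr (ε₁ : ι ≃ σ₁) (v₁ : o) (iv : ι × {v : o // v ≠ v₁}) :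
    placeSplitEquiv ε₁ v₁ (Sum.inr iv) = (iv.1, iv.2.1) := rfl

/-- the inverse on the slice `v₁`: `(i, v₁) ↦ inl (ε₁ i)`. [folklore] -/
@[simp] theorem placeSplitEquiv_symm_apply_same (ε₁ : ι ≃ σ₁) (v₁ : o) (i : ι) :
    (placeSplitEquiv ε₁ v₁).symm (i, v₁) = Sum.inl (ε₁ i) := by
  rw [Equiv.symm_apply_eq, placeSplitEquiv_inl, Equiv.symm_apply_apply]

/-- the inverse off the slice `v₁`: `(i, v) ↦ inr (i, v)`. [folklore] -/
theorem placeSplitEquiv_symm_apply_of_ne (ε₁ : ι ≃ σ₁) (v₁ : o) (i : ι) {v : o} (hv : v ≠ v₁) :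
    (placeSplitEquiv ε₁ v₁).symm (i, v) = Sum.inr (i, ⟨v, hv⟩) := by
  rw [Equiv.symm_apply_eq, placeSplitEquiv_inr]

end Split

/-! ## §2 An element placed at `v₁` acts by a block -/

section Block

variable {ι : Type} [Fintype ι] {o : Type} [Fintype o] [DecidableEq o]
  {σ : o → Type*} [∀ v, Fintype (σ v)] {G : o → Type*} [∀ v, Group (G v)]

/-- **An element placed at `v₁` acts, in the split frame, by the block of its own phase map and the identity**:
`reindexPhase (placeSplitEquiv (ε v₁) v₁) ⇑(piPhaseHom ε ι𝕎ᵥ (Pi.mulSingle v₁ g)) = blockPhase ⇑(ι𝕎ᵥ v₁ g) id`.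
[cite: Weil1964, Chap. I n° 12, p. 160] -/
theorem reindexPhase_placeSplitEquiv_piPhaseHom_mulSingle (ε : ∀ v, ι ≃ σ v)
    (ι𝕎v : ∀ v, G v →* symplecticGroup (polar (dotPairing (σ v)))) (v₁ : o) (g : G v₁) :
    reindexPhase (placeSplitEquiv (ε v₁) v₁)
        (⇑((piPhaseHom ε ι𝕎v (Pi.mulSingle v₁ g)).1 :
          ((ι × o → ℝ) × (ι × o → ℝ)) ≃ₗ[ℝ] ((ι × o → ℝ) × (ι × o → ℝ)))) =
      blockPhase
        (⇑((ι𝕎v v₁ g).1 : ((σ v₁ → ℝ) × (σ v₁ → ℝ)) ≃ₗ[ℝ] ((σ v₁ → ℝ) × (σ v₁ → ℝ))))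
        id := by
  funext pq
  obtain ⟨P, Q⟩ := pq
  rw [coe_piPhaseHom, reindexPhase_apply]
  refine Prod.ext (funext fun k => ?_) (funext fun k => ?_) <;> rcases k with j | ⟨i, v, hv⟩
  · -- first component, slice `v₁`
    simp only [Function.comp_def, placeSplitEquiv_inl, placePhase_fst, Pi.mulSingle_eq_same,
      placeSplitEquiv_symm_apply_same, reindexPhase_apply, Equiv.apply_symm_apply, blockPhase, Sum.elim_inl, id]
  · -- first component, slice `v ≠ v₁`
    simp only [Function.comp_def, placeSplitEquiv_inr, placePhase_fst, Pi.mulSingle_eq_of_ne hv, map_one,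
      OneMemClass.coe_one, LinearEquiv.coe_one, placeSplitEquiv_symm_apply_of_ne _ _ _ hv, reindexPhase_apply, id,
      Equiv.symm_apply_apply, blockPhase, Sum.elim_inr]
  · -- second component, slice `v₁`
    simp only [Function.comp_def, placeSplitEquiv_inl, placePhase_snd, Pi.mulSingle_eq_same,
      placeSplitEquiv_symm_apply_same, reindexPhase_apply, Equiv.apply_symm_apply, blockPhase, Sum.elim_inl, id]
  · -- second component, slice `v ≠ v₁`
    simp only [Function.comp_def, placeSplitEquiv_inr, placePhase_snd, Pi.mulSingle_eq_of_ne hv, map_one,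
      OneMemClass.coe_one, LinearEquiv.coe_one, placeSplitEquiv_symm_apply_of_ne _ _ _ hv, reindexPhase_apply, id,
      Equiv.symm_apply_apply, blockPhase, Sum.elim_inr]

/-- **The same as an identity of homomorphisms into `Sp(ℝ^{σ v₁ ⊕ …})`**:
`reindexSp S (piPhaseHom ε ι𝕎ᵥ (Pi.mulSingle v₁ g)) = spBlock (ι𝕎ᵥ v₁ g, 1)`. [cite: Weil1964, Chap. I n° 12, p. 160] -/
theorem reindexSp_piPhaseHom_mulSingle [DecidableEq ι] [∀ v, DecidableEq (σ v)] (ε : ∀ v, ι ≃ σ v)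
    (ι𝕎v : ∀ v, G v →* symplecticGroup (polar (dotPairing (σ v)))) (v₁ : o) (g : G v₁) :
    reindexSp (placeSplitEquiv (ε v₁) v₁) (piPhaseHom ε ι𝕎v (Pi.mulSingle v₁ g)) =
      spBlock ((ι𝕎v v₁ g), (1 : symplecticGroup (polar (dotPairing (ι × {v : o // v ≠ v₁}))))) := by
  apply Subtype.ext
  apply LinearEquiv.ext
  intro pq
  have h := congrFun (reindexPhase_placeSplitEquiv_piPhaseHom_mulSingle ε ι𝕎v v₁ g) pq
  rw [← coe_reindexSp] at h
  rw [h, coe_spBlock_apply]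
  rfl

/-- **Pointwise, along a section**: for a homomorphism `ϖ : H →* Π v, G v` and `sec : G v₁ →* H` with
`ϖ (sec g) = Pi.mulSingle v₁ g`, the phase action of `sec g` in the split frame is `blockPhase ⇑(ι𝕎ᵥ v₁ g) id` — the
hypothesis `hs` of a block pair for `ι𝕎' := (reindexSp S).comp ((piPhaseHom ε ι𝕎ᵥ).comp ϖ)` and `s := sec`.
[cite: Weil1964, Chap. I n° 12, p. 160; Folland1989, Prop. (1.43)] -/
theorem coe_reindexSp_piPhaseHom_comp_section (ε : ∀ v, ι ≃ σ v)
    (ι𝕎v : ∀ v, G v →* symplecticGroup (polar (dotPairing (σ v)))) (v₁ : o)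
    {H : Type*} [Group H] (ϖ : H →* ∀ v, G v) (sec : G v₁ →* H) (hsec : ∀ g, ϖ (sec g) = Pi.mulSingle v₁ g)
    (g : G v₁) :
    (⇑((((reindexSp (placeSplitEquiv (ε v₁) v₁)).comp ((piPhaseHom ε ι𝕎v).comp ϖ)) (sec g)).1 :
        ((σ v₁ ⊕ (ι × {v : o // v ≠ v₁}) → ℝ) × (σ v₁ ⊕ (ι × {v : o // v ≠ v₁}) → ℝ)) ≃ₗ[ℝ]
          ((σ v₁ ⊕ (ι × {v : o // v ≠ v₁}) → ℝ) × (σ v₁ ⊕ (ι × {v : o // v ≠ v₁}) → ℝ))) :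
        PhaseMap (σ v₁ ⊕ (ι × {v : o // v ≠ v₁}))) =
      blockPhase
        (⇑((ι𝕎v v₁ g).1 : ((σ v₁ → ℝ) × (σ v₁ → ℝ)) ≃ₗ[ℝ] ((σ v₁ → ℝ) × (σ v₁ → ℝ))))
        id := by
  rw [MonoidHom.comp_apply, MonoidHom.comp_apply, hsec, coe_reindexSp]
  exact reindexPhase_placeSplitEquiv_piPhaseHom_mulSingle ε ι𝕎v v₁ g

end Block

end Literature.NumberTheory.Weil1964
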